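import Mathlib
import HarnessLib
import Summits.HubbardSuperconductivity.HubbardSuperconductivity.Theorems.KLProgrammeKLRegimeEngineScaleZeroResummedTwoLegSums
import Summits.HubbardSuperconductivity.HubbardSuperconductivity.Theorems.KLProgrammeKLRegimeEngineScaleZeroCovariance

/-!
# K3 engine, scale `0` AT THE BARE FRAME (`K₀ = 0`, the K3-FLOW scheme's scale-`0` rung; also every admissible fixed frame with the vertex
# `V_N` alone): the plain pinned two-leg grid sum `B₀` of `effAction (S_Nᵀ C^K_{>e₀} S_N) V_N`, BY NAME at the engine's package

Cell gate-hubbard-kl, seat p3 g8.  Under the K3-FLOW ruling (plan g16, KL STATUS 10:17Z: K3 re-split onto the flowing-dispersion family,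
frame sequence `K_n` with `K₀ = 0`) the scale-`0` two-leg step has NO counterterm vertex: its grid object is `effAction C_g V_N` with the BARE
pulled-back scale-`0` covariance `C_g = S_Nᵀ C^0_{>e₀} S_N` and the quartic grid vertex `V_N` alone — exactly the shape of §1 of
`…EngineScaleZeroResummedTwoLegSums` (generic covariance, vertex `V_N`).  Both covariance inputs are landed for every admissible frame `K`
(a fortiori for `K = 0`, `KLRegimeSplit.klFrameOK_zeroC`): the Gram constant `κ₀ = √(2(7 + 1606732))` (`isGramBoundedR_scaleZero_of_frameOK`, k3c2-p1) and the
plain decay constant `α = (N/β)·klScaleZeroA0` (`rowSum_scaleZero_le_A0`/`colSum_…`, k3c4-p2 / p3 g6).  Hence, with `κ = ρ = κ₀`: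

* `hubbardGridCounterQuadratic_frameZero` — `𝒩_{0,N} = 0` (the bare frame has no counterterm: `framePosKernel L 0 = 0`);
* `bareTheta_scaleZero_le_half` — `θ₀ = e·α·‖V_N‖_h/κ₀² ≤ 16e⁹κ₀²·klScaleZeroA0·U ≤ 2^84·U ≤ 1/2` below `klEngU₀3`;
* **`twoLeg_plain_sum_scaleZero_vertexOnly_le_of_klEng`** — for EVERY admissible frame (`FrameOK R U Nsc μ K`, `R.WF`), `klBetaMin ≤ β`,
  `0 < U ≤ klEngU₀3 P R c`, `klEngL₃ β U ≤ L`, `klEngM₃ β U L ≤ M`:  `Σ_{Y : Y 0 = w} ‖kernel₂ (effAction (S_NᵀC^K_{>e₀}S_N) V_N) Y‖ ≤ 32·e⁹·κ₀²·U·(β/N)`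
  on the `N = 4M` grid; at `K = 0` instantiate with `KLRegimeSplit.klFrameOK_zeroC hR U Nsc hμ : FrameOK R U Nsc μ 0` (route-side file
  `…SplitGlue`, not imported here to keep this module route-independent).

Everything is proved; no definitions, no named facts, no sorry.  `--supports stmt-HubbardSuperconductivity-20236` (helper; re-keys verbatim to the
K3-FLOW engine child's scale-`0` rung at `K₀ = 0`).
-/

noncomputable section

namespace Summit.HubbardSuperconductivity.HubbardSuperconductivity.Theorems.EngineV8

set_option linter.dupNamespace false -- summit = problem name (single-conjunct summit), D-0017

open Real Finset Literature.MathematicalPhysics.QuantumLattice Literature.Probability.LatticeModels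
open Literature.Probability.LatticeModels.BattleFederbush GrassmannAlgebra
open Summit.HubbardSuperconductivity.HubbardSuperconductivity.Theorems.KLRegimeSplit
open Summit.HubbardSuperconductivity.HubbardSuperconductivity.Theorems.KLProgrammeLegKernels
open Summit.HubbardSuperconductivity.HubbardSuperconductivity.Theorems.ScaleZeroDecay

/-! ## §1 The bare frame has no counterterm -/

/-- The position kernel of the bare frame vanishes: `Ǩ_L(0) = 0`. -/
theorem framePosKernel_frameZero (L : ℕ) [NeZero L] (z : TorusSite 2 L) : framePosKernel L (0 : TrigPolyC4v) z = 0 := by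
  rw [framePosKernel]
  simp [TrigPolyC4v.eval_zero]

/-- **The bare frame has no grid counterterm**: `𝒩_{0,N} = 0`. -/
theorem hubbardGridCounterQuadratic_frameZero (L N : ℕ) [NeZero L] (β : ℝ) :
    hubbardGridCounterQuadratic L N β (0 : TrigPolyC4v) = 0 := by
  rw [hubbardGridCounterQuadratic]
  simp [framePosKernel_frameZero]

/-! ## §2 The plain two-leg grid sum of `effAction (S_NᵀC^K_{>e₀}S_N) V_N` at the package -/

section KlEng

variable {L M : ℕ} [NeZero L] [NeZero M] {P : SplitConsts} {R : RenConsts} {c U β μ : ℝ} {Nsc : ℕ} {K : TrigPolyC4v}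

/-- **The smallness of the vertex-only scale-`0` step at the package**: with `κ = ρ = κ₀ = √(2(7 + 1606732))`, `α = (N/β)·klScaleZeroA0` and the
quartic-only profile: `θ₀ ≤ 16e⁹κ₀²·klScaleZeroA0·U ≤ 2^84·U ≤ 1/2` for `0 < U ≤ klEngU₀3 P R c`, `0 < β`. -/
theorem bareTheta_scaleZero_le_half (hβ0 : 0 < β) (hU : 0 < U) (hU₀ : U ≤ klEngU₀3 P R c) (Ng : ℕ) [NeZero Ng] :
    Real.exp 1 * ((Ng : ℝ) / β * klScaleZeroA0) *
        ((Real.exp 2 * (Real.sqrt (2 * (7 + 1606732)) + Real.sqrt (2 * (7 + 1606732)))) ^ 4 * (|U| * |β| / Ng)) /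
          Real.sqrt (2 * (7 + 1606732)) ^ 2 ≤ 1 / 2 := by
  set kk : ℝ := Real.sqrt (2 * (7 + 1606732)) with hkk
  have hkk2 : kk ^ 2 = 2 * (7 + 1606732) := by rw [hkk, Real.sq_sqrt (by norm_num)]
  have hkkpos : 0 < kk := by rw [hkk]; positivity
  have hNg : 0 < (Ng : ℝ) := by have := NeZero.ne Ng; positivity
  have hA := klScaleZeroA0_le_two_pow
  have hA0 := klScaleZeroA0_pos.le
  have he1 : Real.exp 1 ≤ 3 := by have := Real.exp_one_lt_d9; linarith
  have he0 : 0 ≤ Real.exp 1 := (Real.exp_pos 1).le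
  have he2 : Real.exp 2 = Real.exp 1 ^ 2 := by rw [← Real.exp_nat_mul]; norm_num
  have hU1 : U ≤ 1 / (2 : ℝ) ^ 120 := hU₀.trans (klEngU₀3_le_two_pow P R c)
  rw [abs_of_pos hU, abs_of_pos hβ0]
  have hlhs : Real.exp 1 * ((Ng : ℝ) / β * klScaleZeroA0) * ((Real.exp 2 * (kk + kk)) ^ 4 * (U * β / Ng)) / kk ^ 2 =
      16 * Real.exp 1 ^ 9 * kk ^ 2 * klScaleZeroA0 * U := by
    rw [he2]
    field_simp
    ring
  rw [hlhs]
  have he9 : Real.exp 1 ^ 9 ≤ (3 : ℝ) ^ 9 := pow_le_pow_left₀ he0 he1 9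
  have hk22 : kk ^ 2 ≤ (2 : ℝ) ^ 22 := by rw [hkk2]; norm_num
  calc 16 * Real.exp 1 ^ 9 * kk ^ 2 * klScaleZeroA0 * U
      ≤ 16 * (3 : ℝ) ^ 9 * (2 : ℝ) ^ 22 * (2 : ℝ) ^ 43 * (1 / (2 : ℝ) ^ 120) := by
        have h1 : 0 ≤ Real.exp 1 ^ 9 := by positivity
        have h2 : 0 ≤ kk ^ 2 := by positivity
        gcongr
    _ ≤ 1 / 2 := by norm_num

/-- **THE PLAIN TWO-LEG SUM OF THE VERTEX-ONLY SCALE-`0` STEP AT THE PACKAGE, BY NAME.**  For EVERY admissible frame (`FrameOK R U Nsc μ K`),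
`klBetaMin ≤ β`, `0 < U ≤ klEngU₀3 P R c`, `klEngL₃ β U ≤ L`, `klEngM₃ β U L ≤ M`, on the `N = 4M` grid and every pinned leg `w`:
`Σ_{Y : Y 0 = w} ‖kernel₂ (effAction (S_NᵀC^K_{>e₀}S_N) V_N) Y‖ ≤ 32·e⁹·κ₀²·U·(β/N)`, `κ₀² = 2(7 + 1606732)` — the input `B₀` of the scale-`0`
two-leg closers when the vertex carries NO counterterm (K3-FLOW scale `0`; (ρ2) after resummation reads `…ResummedTwoLegSums` instead). -/
theorem twoLeg_plain_sum_scaleZero_vertexOnly_le_of_klEng (hK : FrameOK R U Nsc μ K) (hβ : klBetaMin ≤ β)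
    (hU : 0 < U) (hU₀ : U ≤ klEngU₀3 P R c) (hL : klEngL₃ β U ≤ L) (hM : klEngM₃ β U L ≤ M)
    (w : GridLeg (GridPoint L (2 * (2 * M)))) :
    ∑ Y ∈ univ.filter (fun Y : Fin 2 → GridLeg (GridPoint L (2 * (2 * M))) => Y 0 = w),
        ‖kernel ℂ (effAction ℂ ((hubbardGridSub L M β (2 * (2 * M))).transpose * hubbardCovAboveCT L M β μ 0 K klE0 *
            hubbardGridSub L M β (2 * (2 * M))) (hubbardGridInteraction L (2 * (2 * M)) β U)) 2 Y‖ ≤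
      32 * Real.exp 1 ^ 9 * (2 * (7 + 1606732)) * U * (β / (((2 * (2 * M) : ℕ) : ℝ))) := by
  haveI : NeZero (2 * (2 * M)) := ⟨by have := NeZero.ne M; omega⟩
  have hβ0 : 0 < β := beta_pos_of_klBetaMin_le hβ
  have hβL : β ≤ L := le_of_klEngL₃_le hL
  have hL15 := two_pow_fifteen_le_of_klEngL₃_le hβ hL
  have hβM := pow_three_le_of_klEng hβ hL hM
  have hNg : 0 < (((2 * (2 * M) : ℕ) : ℝ)) := by have := NeZero.ne M; positivity
  set kk : ℝ := Real.sqrt (2 * (7 + 1606732)) with hkk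
  have hkk2 : kk ^ 2 = 2 * (7 + 1606732) := by rw [hkk, Real.sq_sqrt (by norm_num)]
  have hkkpos : 0 < kk := by rw [hkk]; positivity
  -- the two covariance inputs by name
  have hGB := isGramBoundedR_scaleZero_of_frameOK (M := M) hK hβ hL15 hβL
  have hrow := fun X => rowSum_scaleZero_le_A0 (L := L) hK hβ hβM X
  have hcol := fun Y => colSum_scaleZero_le_A0 (L := L) hK hβ hβM Y
  have hA0 := klScaleZeroA0_pos
  have hαpos : 0 < (((2 * (2 * M) : ℕ) : ℝ)) / β * klScaleZeroA0 := by positivity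
  -- smallness
  have hθ := bareTheta_scaleZero_le_half (P := P) (R := R) (c := c) hβ0 hU hU₀ (2 * (2 * M))
  have hnV := normV_quarticProfile_le (GridLeg (GridPoint L (2 * (2 * M)))) kk kk β U (2 * (2 * M))
  have hnV0 : 0 ≤ normV (GridLeg (GridPoint L (2 * (2 * M)))) kk kk (fun m' => if m' = 2 then |U| * |β| / (((2 * (2 * M) : ℕ) : ℝ)) else 0) :=
    normV_nonneg hkkpos.le hkkpos.le (quarticProfile_nonneg β U (2 * (2 * M)))
  have hθ' : Real.exp 1 * ((((2 * (2 * M) : ℕ) : ℝ)) / β * klScaleZeroA0) *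
      normV (GridLeg (GridPoint L (2 * (2 * M)))) kk kk (fun m' => if m' = 2 then |U| * |β| / (((2 * (2 * M) : ℕ) : ℝ)) else 0) / kk ^ 2 ≤ 1 / 2 := by
    refine le_trans ?_ hθ
    have he0 : 0 ≤ Real.exp 1 := (Real.exp_pos 1).le
    gcongr
  have hθlt : Real.exp 1 * ((((2 * (2 * M) : ℕ) : ℝ)) / β * klScaleZeroA0) *
      normV (GridLeg (GridPoint L (2 * (2 * M)))) kk kk (fun m' => if m' = 2 then |U| * |β| / (((2 * (2 * M) : ℕ) : ℝ)) else 0) / kk ^ 2 < 1 := by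
    linarith
  have h := resummedTwoLeg_plain_sum_le_of_gridStep _ β U hkkpos hGB hαpos hrow hcol hkkpos hθlt w
  refine h.trans ?_
  have he2 : Real.exp 2 = Real.exp 1 ^ 2 := by rw [← Real.exp_nat_mul]; norm_num
  have hden1 : (1 : ℝ) / 2 ≤ 1 - Real.exp 1 * ((((2 * (2 * M) : ℕ) : ℝ)) / β * klScaleZeroA0) *
      normV (GridLeg (GridPoint L (2 * (2 * M)))) kk kk (fun m' => if m' = 2 then |U| * |β| / (((2 * (2 * M) : ℕ) : ℝ)) else 0) / kk ^ 2 := by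
    linarith
  have hnum : kk⁻¹ ^ 2 * (Real.exp 1 * normV (GridLeg (GridPoint L (2 * (2 * M)))) kk kk
      (fun m' => if m' = 2 then |U| * |β| / (((2 * (2 * M) : ℕ) : ℝ)) else 0)) ≤
      kk⁻¹ ^ 2 * (Real.exp 1 * ((Real.exp 2 * (kk + kk)) ^ 4 * (|U| * |β| / (((2 * (2 * M) : ℕ) : ℝ))))) := by
    have he0 : 0 ≤ Real.exp 1 := (Real.exp_pos 1).le
    gcongr
  have hnum0 : 0 ≤ kk⁻¹ ^ 2 * (Real.exp 1 * normV (GridLeg (GridPoint L (2 * (2 * M)))) kk kk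
      (fun m' => if m' = 2 then |U| * |β| / (((2 * (2 * M) : ℕ) : ℝ)) else 0)) := by positivity
  calc kk⁻¹ ^ 2 * (Real.exp 1 * normV (GridLeg (GridPoint L (2 * (2 * M)))) kk kk
        (fun m' => if m' = 2 then |U| * |β| / (((2 * (2 * M) : ℕ) : ℝ)) else 0)) /
        (1 - Real.exp 1 * ((((2 * (2 * M) : ℕ) : ℝ)) / β * klScaleZeroA0) *
          normV (GridLeg (GridPoint L (2 * (2 * M)))) kk kk (fun m' => if m' = 2 then |U| * |β| / (((2 * (2 * M) : ℕ) : ℝ)) else 0) / kk ^ 2)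
      ≤ kk⁻¹ ^ 2 * (Real.exp 1 * ((Real.exp 2 * (kk + kk)) ^ 4 * (|U| * |β| / (((2 * (2 * M) : ℕ) : ℝ))))) / (1 / 2) :=
        div_le_div₀ (hnum0.trans hnum) hnum (by norm_num) hden1
    _ = 32 * Real.exp 1 ^ 9 * (2 * (7 + 1606732)) * U * (β / (((2 * (2 * M) : ℕ) : ℝ))) := by
        rw [abs_of_pos hU, abs_of_pos hβ0, he2, ← hkk2]
        field_simp
        ring

end KlEng

end Summit.HubbardSuperconductivity.HubbardSuperconductivity.Theorems.EngineV8

end
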